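import Mathlib.Analysis.Complex.Basic
import Mathlib.Data.Matrix.Basic
import HarnessLib

/-!
# Venture KdS — the comparison lemma for the doubly-resonant truncated recurrence
# (STRUCTURE §8 Q3′, T10 Lemma A)

HONEST FRAMING (venture `Summits/Ventures/KdS`, cell `pub-kds`, seat P1 g11; optional object named
by LEAD g11 2026-08-23T21:07Z). This file is SELF-CONTAINED FINITE-DIMENSIONAL LINEAR ALGEBRA and
makes no claim about Kerr–de Sitter, the Final State Conjecture, the census records or
`RouteW.NonExtremeStrata`. It types "Lemma A" of the cell's pen-and-paper note
`lit/Q3PRIME-CASES.md` (LIT-1 g41, T10, §2) in the abstract form stated there (§5, "Lean-ability"):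

* `RouteW.DoublyResonant.eigenvalue_re_mul_weightedNormSq` — the WEIGHTED REAL-PART IDENTITY: if `A`
  is a real square matrix and `w` are real weights with `w i * A i j = -(w j * A j i)` for `i ≠ j`
  (i.e. `diag(w) · A` is skew-symmetric off the diagonal), then for every complex eigen-relation
  `∑ j, A i j * v j = q * v i` one has `Re q · Σ_i w_i |v_i|² = Σ_i w_i A_ii |v_i|²`. Proof: with
  `S = Σ_{ij} w_i A_ij conj(v_i) v_j = q · Σ_i w_i |v_i|²` the skew relation gives
  `S + conj S = 2 Σ_i w_i A_ii |v_i|²`.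
* `eigenvalue_re_nonneg_of_weights` / `eigenvalue_re_le_of_weights` / `le_eigenvalue_re_of_weights`
  — hence, for POSITIVE weights and `v ≠ 0`, `min_i A_ii ≤ Re q ≤ max_i A_ii` (the "comparison
  argument"; no reality of the spectrum is needed or claimed);
  `eigenvector_apply_eq_zero_of_re_eq_zero` is the equality case.
* `exists_weights_of_tridiagonal` — a real tridiagonal matrix on `Fin (d+1)` whose off-diagonal
  products `A i (i+1) * A (i+1) i` are all NEGATIVE admits such positive weights
  (`w (i+1) = -w i · A i (i+1) / A (i+1) i`).
* `tridiagonal_eigenvalue_re_nonneg` / `tridiagonal_eigenvalue_re_le` /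
  `tridiagonal_eigenvalue_re_pos` — LEMMA A as used in T10: negative off-diagonal products and a
  nonnegative diagonal force `0 ≤ Re q ≤ max_i A_ii` for every eigenvalue `q`, and `0 < Re q` once
  `d ≥ 1` and the diagonal is positive past its first entry.

In T10 the matrix is the `(d+1) × (d+1)` truncation (1.1) of the Heun three-term recurrence at a
doubly-resonant point (`A_{i,i+1} = -t(i+1)(i+γ) < 0`, `A_{i+1,i} = (i+α′)(d-i) > 0`,
`A_{ii} = D_i ≥ 0`, `D_0 = 0 < D_i` for `i ≥ 1`); the bookkeeping that (1.1) is the tree's Heun form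
at those parameters is NOT done here (T10 §5 says so too). 0 cited facts, 0 hypotheses beyond the
displayed ones, no `sorry`.
-/

namespace Summit.Ventures.KdS.RouteW.DoublyResonant

open Complex ComplexConjugate Finset Matrix

section Weighted

variable {n : Type*} [Fintype n]

/-- **Weighted real-part identity.** For a real square matrix `A`, real weights `w` with
`w i * A i j = -(w j * A j i)` whenever `i ≠ j`, and a complex eigen-relation
`∑ j, A i j * v j = q * v i`: `Re q * ∑ i, w i * |v i|² = ∑ i, w i * A i i * |v i|²`. -/
theorem eigenvalue_re_mul_weightedNormSq (A : Matrix n n ℝ) (w : n → ℝ)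
    (hskew : ∀ i j, i ≠ j → w i * A i j = -(w j * A j i)) {q : ℂ} {v : n → ℂ}
    (heig : ∀ i, ∑ j, (A i j : ℂ) * v j = q * v i) :
    q.re * ∑ i, w i * normSq (v i) = ∑ i, w i * A i i * normSq (v i) := by
  set S : ℂ := ∑ i, ∑ j, ((w i * A i j : ℝ) : ℂ) * (conj (v i) * v j) with hSdef
  -- (1) `S = q * Σ w_i |v_i|²` from the eigen-relation.
  have h1 : S = q * ((∑ i, w i * normSq (v i) : ℝ) : ℂ) := by
    rw [hSdef, Complex.ofReal_sum, Finset.mul_sum]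
    refine Finset.sum_congr rfl fun i _ => ?_
    calc ∑ j, ((w i * A i j : ℝ) : ℂ) * (conj (v i) * v j)
        = (w i : ℂ) * conj (v i) * ∑ j, (A i j : ℂ) * v j := by
          rw [Finset.mul_sum]
          refine Finset.sum_congr rfl fun j _ => ?_
          push_cast
          ring
      _ = (w i : ℂ) * conj (v i) * (q * v i) := by rw [heig i]
      _ = q * ((w i * normSq (v i) : ℝ) : ℂ) := by
          rw [Complex.ofReal_mul, Complex.normSq_eq_conj_mul_self]
          ring
  -- (2) `conj S` is the transposed sum.
  have h2 : conj S = ∑ i, ∑ j, ((w j * A j i : ℝ) : ℂ) * (conj (v i) * v j) := by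
    rw [hSdef, map_sum]
    simp only [map_sum, map_mul, Complex.conj_ofReal, Complex.conj_conj]
    rw [Finset.sum_comm]
    refine Finset.sum_congr rfl fun i _ => Finset.sum_congr rfl fun j _ => ?_
    ring
  -- (3) `S + conj S = Σ 2 w_i A_ii |v_i|²` by the skew relation.
  have h3 : S + conj S = ((∑ i, 2 * (w i * A i i * normSq (v i)) : ℝ) : ℂ) := by
    rw [h2, hSdef, ← Finset.sum_add_distrib, Complex.ofReal_sum]
    refine Finset.sum_congr rfl fun i _ => ?_
    rw [← Finset.sum_add_distrib, Finset.sum_eq_single i]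
    · rw [Complex.ofReal_mul, Complex.ofReal_mul, Complex.ofReal_mul,
        Complex.normSq_eq_conj_mul_self]
      push_cast
      ring
    · intro j _ hji
      have h0 : w i * A i j + w j * A j i = 0 := by rw [hskew i j (Ne.symm hji)]; ring
      rw [← add_mul, ← Complex.ofReal_add, h0, Complex.ofReal_zero, zero_mul]
    · intro hi
      exact absurd (Finset.mem_univ i) hi
  -- (4) compare real parts.
  have h4 : S + conj S = ((2 * S.re : ℝ) : ℂ) := Complex.add_conj S
  have h5 : S.re = q.re * ∑ i, w i * normSq (v i) := by
    rw [h1, mul_comm, Complex.re_ofReal_mul, mul_comm]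
  have h6 : 2 * S.re = ∑ i, 2 * (w i * A i i * normSq (v i)) :=
    Complex.ofReal_injective (h4.symm.trans h3)
  rw [← h5]
  have h7 : ∑ i, 2 * (w i * A i i * normSq (v i)) = 2 * ∑ i, w i * A i i * normSq (v i) := by
    rw [Finset.mul_sum]
  linarith [h6, h7]

/-- The weighted norm `∑ i, w i * |v i|²` is positive for positive weights and `v ≠ 0`. -/
theorem weightedNormSq_pos (w : n → ℝ) (hw : ∀ i, 0 < w i) {v : n → ℂ} (hv : v ≠ 0) :
    0 < ∑ i, w i * normSq (v i) := by
  obtain ⟨i₀, hi₀⟩ := Function.ne_iff.mp hv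
  refine Finset.sum_pos' (fun i _ => mul_nonneg (hw i).le (normSq_nonneg _))
    ⟨i₀, Finset.mem_univ _, ?_⟩
  exact mul_pos (hw i₀) (Complex.normSq_pos.mpr hi₀)

/-- **Comparison, lower sign.** Positive weights as above and a nonnegative diagonal force
`0 ≤ Re q` for every complex eigen-relation with `v ≠ 0`. -/
theorem eigenvalue_re_nonneg_of_weights (A : Matrix n n ℝ) (w : n → ℝ) (hw : ∀ i, 0 < w i)
    (hskew : ∀ i j, i ≠ j → w i * A i j = -(w j * A j i)) (hdiag : ∀ i, 0 ≤ A i i)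
    {q : ℂ} {v : n → ℂ} (hv : v ≠ 0) (heig : ∀ i, ∑ j, (A i j : ℂ) * v j = q * v i) :
    0 ≤ q.re := by
  have hid := eigenvalue_re_mul_weightedNormSq A w hskew heig
  have hP := weightedNormSq_pos w hw hv
  have hN : 0 ≤ ∑ i, w i * A i i * normSq (v i) :=
    Finset.sum_nonneg fun i _ => mul_nonneg (mul_nonneg (hw i).le (hdiag i)) (normSq_nonneg _)
  by_contra hq
  have : q.re * ∑ i, w i * normSq (v i) < 0 := mul_neg_of_neg_of_pos (lt_of_not_ge hq) hP
  linarith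

/-- **Comparison, upper bound.** Positive weights as above and `A i i ≤ M` for all `i` force
`Re q ≤ M`. -/
theorem eigenvalue_re_le_of_weights (A : Matrix n n ℝ) (w : n → ℝ) (hw : ∀ i, 0 < w i)
    (hskew : ∀ i j, i ≠ j → w i * A i j = -(w j * A j i)) {M : ℝ} (hdiag : ∀ i, A i i ≤ M)
    {q : ℂ} {v : n → ℂ} (hv : v ≠ 0) (heig : ∀ i, ∑ j, (A i j : ℂ) * v j = q * v i) :
    q.re ≤ M := by
  have hid := eigenvalue_re_mul_weightedNormSq A w hskew heig
  have hP := weightedNormSq_pos w hw hv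
  have hN : ∑ i, w i * A i i * normSq (v i) ≤ M * ∑ i, w i * normSq (v i) := by
    rw [Finset.mul_sum]
    refine Finset.sum_le_sum fun i _ => ?_
    have := mul_le_mul_of_nonneg_left (hdiag i) (mul_nonneg (hw i).le (normSq_nonneg (v i)))
    linarith [this]
  exact le_of_mul_le_mul_right (by linarith [hid, hN]) hP

/-- **Comparison, lower bound.** Positive weights as above and `m ≤ A i i` for all `i` force
`m ≤ Re q`. -/
theorem le_eigenvalue_re_of_weights (A : Matrix n n ℝ) (w : n → ℝ) (hw : ∀ i, 0 < w i)
    (hskew : ∀ i j, i ≠ j → w i * A i j = -(w j * A j i)) {m : ℝ} (hdiag : ∀ i, m ≤ A i i)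
    {q : ℂ} {v : n → ℂ} (hv : v ≠ 0) (heig : ∀ i, ∑ j, (A i j : ℂ) * v j = q * v i) :
    m ≤ q.re := by
  have hid := eigenvalue_re_mul_weightedNormSq A w hskew heig
  have hP := weightedNormSq_pos w hw hv
  have hN : m * ∑ i, w i * normSq (v i) ≤ ∑ i, w i * A i i * normSq (v i) := by
    rw [Finset.mul_sum]
    refine Finset.sum_le_sum fun i _ => ?_
    have := mul_le_mul_of_nonneg_left (hdiag i) (mul_nonneg (hw i).le (normSq_nonneg (v i)))
    linarith [this]
  exact le_of_mul_le_mul_right (by linarith [hid, hN]) hP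

/-- **Equality case.** Positive weights, nonnegative diagonal and `Re q = 0` force the
eigenvector to vanish at every index whose diagonal entry is positive. -/
theorem eigenvector_apply_eq_zero_of_re_eq_zero (A : Matrix n n ℝ) (w : n → ℝ)
    (hw : ∀ i, 0 < w i) (hskew : ∀ i j, i ≠ j → w i * A i j = -(w j * A j i))
    (hdiag : ∀ i, 0 ≤ A i i) {q : ℂ} {v : n → ℂ}
    (heig : ∀ i, ∑ j, (A i j : ℂ) * v j = q * v i) (hq : q.re = 0) {i : n} (hi : 0 < A i i) :
    v i = 0 := by
  have hid := eigenvalue_re_mul_weightedNormSq A w hskew heig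
  rw [hq, zero_mul] at hid
  have hterm : ∀ j ∈ (Finset.univ : Finset n), 0 ≤ w j * A j j * normSq (v j) :=
    fun j _ => mul_nonneg (mul_nonneg (hw j).le (hdiag j)) (normSq_nonneg _)
  have hzero := (Finset.sum_eq_zero_iff_of_nonneg hterm).mp hid.symm i (Finset.mem_univ i)
  have hwA : 0 < w i * A i i := mul_pos (hw i) hi
  have hn : normSq (v i) = 0 := by
    rcases mul_eq_zero.mp hzero with h | h
    · exact absurd h hwA.ne'
    · exact h
  exact Complex.normSq_eq_zero.mp hn

/-- Matrix form of the eigen-relation: `(A.map ofReal) *ᵥ v = q • v` unfolds to the componentwise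
relation used above. -/
theorem eigRel_of_mulVec (A : Matrix n n ℝ) {q : ℂ} {v : n → ℂ}
    (h : (A.map ((↑) : ℝ → ℂ)) *ᵥ v = q • v) (i : n) :
    ∑ j, (A i j : ℂ) * v j = q * v i := by
  have := congrFun h i
  simpa [Matrix.mulVec, dotProduct] using this

end Weighted

section Tridiagonal

variable {d : ℕ}

/-- `a * b < 0 ⟹ 0 < -a / b` (the ratio defining the weights below is positive). -/
private theorem neg_div_pos_of_mul_neg {a b : ℝ} (h : a * b < 0) : 0 < -a / b := by
  have hb : b ≠ 0 := by
    rintro rfl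
    simp at h
  have : -a / b = -(a * b) / (b * b) := by field_simp
  rw [this]
  exact div_pos (by linarith) (mul_self_pos.mpr hb)

/-- **Weights for a sign-antisymmetric tridiagonal matrix.** A real matrix on `Fin (d+1)` vanishing
outside the three central diagonals, with every off-diagonal product `A i (i+1) * A (i+1) i`
NEGATIVE, admits positive weights `w` with `w i * A i j = -(w j * A j i)` for all `i ≠ j` (so that
`diag(w) · A` is diagonal plus skew-symmetric). -/
theorem exists_weights_of_tridiagonal (A : Matrix (Fin (d + 1)) (Fin (d + 1)) ℝ)
    (hband : ∀ i j : Fin (d + 1), (i : ℕ) + 1 < j ∨ (j : ℕ) + 1 < i → A i j = 0)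
    (hprod : ∀ i j : Fin (d + 1), (j : ℕ) = i + 1 → A i j * A j i < 0) :
    ∃ w : Fin (d + 1) → ℝ, (∀ i, 0 < w i) ∧ ∀ i j, i ≠ j → w i * A i j = -(w j * A j i) := by
  -- the ratio `r k = -A k (k+1) / A (k+1) k` (and `1` past the end), positive by `hprod`
  let r : ℕ → ℝ := fun k =>
    if h : k + 1 < d + 1 then
      -(A ⟨k, Nat.lt_of_succ_lt h⟩ ⟨k + 1, h⟩) / A ⟨k + 1, h⟩ ⟨k, Nat.lt_of_succ_lt h⟩
    else 1
  have hr_eq : ∀ k (hk : k + 1 < d + 1), r k =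
      -(A ⟨k, Nat.lt_of_succ_lt hk⟩ ⟨k + 1, hk⟩) / A ⟨k + 1, hk⟩ ⟨k, Nat.lt_of_succ_lt hk⟩ := by
    intro k hk
    simp only [r, dif_pos hk]
  have hr : ∀ k, 0 < r k := by
    intro k
    by_cases hk : k + 1 < d + 1
    · rw [hr_eq k hk]
      exact neg_div_pos_of_mul_neg (hprod _ _ rfl)
    · simp only [r, dif_neg hk]
      exact one_pos
  -- the weights `g 0 = 1`, `g (k+1) = g k * r k`
  let g : ℕ → ℝ := fun k => Nat.rec (motive := fun _ => ℝ) 1 (fun m acc => acc * r m) k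
  have hg0 : g 0 = 1 := rfl
  have hgs : ∀ k, g (k + 1) = g k * r k := fun k => rfl
  have hgpos : ∀ k, 0 < g k := by
    intro k
    induction k with
    | zero => rw [hg0]; exact one_pos
    | succ m ih => rw [hgs]; exact mul_pos ih (hr m)
  -- the relation along the superdiagonal, in ℕ-coordinates
  have key : ∀ k (hk' : k < d + 1) (hk : k + 1 < d + 1),
      g k * A ⟨k, hk'⟩ ⟨k + 1, hk⟩ = -(g (k + 1) * A ⟨k + 1, hk⟩ ⟨k, hk'⟩) := by
    intro k hk' hk
    have hneg : A ⟨k, hk'⟩ ⟨k + 1, hk⟩ * A ⟨k + 1, hk⟩ ⟨k, hk'⟩ < 0 := hprod _ _ rfl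
    have hne : A ⟨k + 1, hk⟩ ⟨k, hk'⟩ ≠ 0 := by
      intro h0
      rw [h0, mul_zero] at hneg
      exact lt_irrefl _ hneg
    rw [hgs k, hr_eq k hk]
    field_simp
  refine ⟨fun i => g i, fun i => hgpos i, ?_⟩
  intro i j hij
  obtain ⟨i, hi⟩ := i
  obtain ⟨j, hj⟩ := j
  have hne : i ≠ j := fun h => hij (Fin.ext h)
  by_cases h1 : j = i + 1
  · subst h1
    exact key i hi hj
  by_cases h2 : i = j + 1
  · subst h2
    have := key j hj hi
    linarith
  · have h3 : i + 1 < j ∨ j + 1 < i := by omega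
    have h4 : j + 1 < i ∨ i + 1 < j := by omega
    rw [hband ⟨i, hi⟩ ⟨j, hj⟩ h3, hband ⟨j, hj⟩ ⟨i, hi⟩ h4]
    ring

/-- **Lemma A of T10 (lower sign).** A real tridiagonal matrix on `Fin (d+1)` with negative
off-diagonal products and nonnegative diagonal: every complex eigen-relation
`∑ j, A i j * v j = q * v i` with `v ≠ 0` has `0 ≤ Re q`. -/
theorem tridiagonal_eigenvalue_re_nonneg (A : Matrix (Fin (d + 1)) (Fin (d + 1)) ℝ)
    (hband : ∀ i j : Fin (d + 1), (i : ℕ) + 1 < j ∨ (j : ℕ) + 1 < i → A i j = 0)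
    (hprod : ∀ i j : Fin (d + 1), (j : ℕ) = i + 1 → A i j * A j i < 0)
    (hdiag : ∀ i, 0 ≤ A i i) {q : ℂ} {v : Fin (d + 1) → ℂ} (hv : v ≠ 0)
    (heig : ∀ i, ∑ j, (A i j : ℂ) * v j = q * v i) : 0 ≤ q.re := by
  obtain ⟨w, hw, hskew⟩ := exists_weights_of_tridiagonal A hband hprod
  exact eigenvalue_re_nonneg_of_weights A w hw hskew hdiag hv heig

/-- **Lemma A of T10 (upper bound).** Same matrix class: every complex eigen-relation with `v ≠ 0`
has `Re q ≤ M` as soon as every diagonal entry is `≤ M`. -/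
theorem tridiagonal_eigenvalue_re_le (A : Matrix (Fin (d + 1)) (Fin (d + 1)) ℝ)
    (hband : ∀ i j : Fin (d + 1), (i : ℕ) + 1 < j ∨ (j : ℕ) + 1 < i → A i j = 0)
    (hprod : ∀ i j : Fin (d + 1), (j : ℕ) = i + 1 → A i j * A j i < 0) {M : ℝ}
    (hdiag : ∀ i, A i i ≤ M) {q : ℂ} {v : Fin (d + 1) → ℂ} (hv : v ≠ 0)
    (heig : ∀ i, ∑ j, (A i j : ℂ) * v j = q * v i) : q.re ≤ M := by
  obtain ⟨w, hw, hskew⟩ := exists_weights_of_tridiagonal A hband hprod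
  exact eigenvalue_re_le_of_weights A w hw hskew hdiag hv heig

/-- **Lemma A of T10 (strict lower sign).** If moreover `d ≥ 1` and every diagonal entry past the
first is POSITIVE (`A 0 0` may vanish, as in T10 where `D_0 = 0 < D_i`), then `0 < Re q`: an
eigenvector with `Re q = 0` would be a multiple of `e_0`, and row `1` of the eigen-relation would
force `A 1 0 = 0`, contradicting `A 0 1 * A 1 0 < 0`. -/
theorem tridiagonal_eigenvalue_re_pos (A : Matrix (Fin (d + 1)) (Fin (d + 1)) ℝ) (hd : 1 ≤ d)
    (hband : ∀ i j : Fin (d + 1), (i : ℕ) + 1 < j ∨ (j : ℕ) + 1 < i → A i j = 0)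
    (hprod : ∀ i j : Fin (d + 1), (j : ℕ) = i + 1 → A i j * A j i < 0)
    (hdiag : ∀ i, 0 ≤ A i i) (hdiag' : ∀ i : Fin (d + 1), 1 ≤ (i : ℕ) → 0 < A i i)
    {q : ℂ} {v : Fin (d + 1) → ℂ} (hv : v ≠ 0)
    (heig : ∀ i, ∑ j, (A i j : ℂ) * v j = q * v i) : 0 < q.re := by
  obtain ⟨w, hw, hskew⟩ := exists_weights_of_tridiagonal A hband hprod
  have hge : 0 ≤ q.re := eigenvalue_re_nonneg_of_weights A w hw hskew hdiag hv heig
  rcases hge.lt_or_eq with hpos | hzero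
  · exact hpos
  exfalso
  -- `Re q = 0`: the eigenvector vanishes past index 0
  have hvan : ∀ i : Fin (d + 1), 1 ≤ (i : ℕ) → v i = 0 := fun i hi =>
    eigenvector_apply_eq_zero_of_re_eq_zero A w hw hskew hdiag heig hzero.symm (hdiag' i hi)
  have h0lt : 0 < d + 1 := Nat.succ_pos d
  have h1lt : 1 < d + 1 := by omega
  set i0 : Fin (d + 1) := ⟨0, h0lt⟩ with hi0
  set i1 : Fin (d + 1) := ⟨1, h1lt⟩ with hi1
  -- `v 0 ≠ 0` since `v ≠ 0`
  have hv0 : v i0 ≠ 0 := by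
    intro h0
    apply hv
    funext i
    by_cases hi : 1 ≤ (i : ℕ)
    · exact hvan i hi
    · have : i = i0 := Fin.ext (by simp only [hi0]; omega)
      rw [this, h0]
      rfl
  -- row 1 of the eigen-relation: only the `j = 0` term survives
  have hrow := heig i1
  rw [hvan i1 (le_refl _), mul_zero, Finset.sum_eq_single i0] at hrow
  · have hA10 : (A i1 i0 : ℂ) = 0 := by
      rcases mul_eq_zero.mp hrow with h | h
      · exact h
      · exact absurd h hv0
    have hA10' : A i1 i0 = 0 := by exact_mod_cast hA10
    have hneg : A i0 i1 * A i1 i0 < 0 := hprod i0 i1 rfl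
    rw [hA10', mul_zero] at hneg
    exact lt_irrefl _ hneg
  · intro j _ hj
    by_cases hj1 : 1 ≤ (j : ℕ)
    · rw [hvan j hj1, mul_zero]
    · exfalso
      exact hj (Fin.ext (by simp only [hi0]; omega))
  · intro h
    exact absurd (Finset.mem_univ _) h

end Tridiagonal

end Summit.Ventures.KdS.RouteW.DoublyResonant
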